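import Summits.HubbardSuperconductivity.HubbardSuperconductivity.Theorems.TwistGapTgCruxGlue
import Summits.HubbardSuperconductivity.HubbardSuperconductivity.Theorems.TwistGapTgCondensationOfRigidity
import Summits.HubbardSuperconductivity.HubbardSuperconductivity.Theorems.DeformationLadderLadderThesisRigidityReduction
import Summits.HubbardSuperconductivity.HubbardSuperconductivity.Theorems.TwTipContinuation.Negative.SeededChords

/-!
# Crux `LowEnergyRigidity` (stmt-HubbardSuperconductivity-1892) — STRATEGY CENSUS v5, typed part

Companion of `Cruxes/LowEnergyRigidity/STRATEGY-CENSUS.md` v5 (crux-strategist seat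
`planner-cstrat-stmt-HubbardSuperconductivity-1892-s2-0`, 2026-08-17). Sorry-free; it certifies from
theorems already in the tree the two claims of v5 that are theorems rather than judgements.

* **S15 (Strengthen / Transfer along the route's own family).** Window rigidity of the deformed
  model `K_L(U,g) = H_L − (g/L²)·pFᴴpF`, UNIFORM on any coupling interval `g ∈ (0, g₀]` however short
  (`UniformDeformedWindowRigidity`), is EQUIVALENT to the crux, and the crux is in turn equivalent to
  window rigidity uniform on the whole attractive half-line `g ≥ 0` (`AllCouplingsWindowRigidity`):
  `lowEnergyRigidity_iff_uniformDeformedWindowRigidity`, `lowEnergyRigidity_iff_allCouplingsWindowRigidity`.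
  Both directions are two-line FIXED-`L` arguments (`g := min g₀ (κ/(64L²))` one way; a case split on
  the pair intensity of the window vector against that of a pure ground state the other way). Hence the
  deformation parameter offers NO interpolation handle: the tree's `deformedWindowRigidity`
  (Cruxes/LowEnergyRigidity/StrategyCensus.lean; constants `U₀ = κ(g,δ)`, `a = (κ(g,δ) − U)/(2g)`) covers, at
  fixed `U > 0`, only `g ≥ g_*(U,δ) > 0`, and uniformity on the remaining corner `(0, g_*)` is not a rung
  below the crux but the crux itself.
* **D13 (Decomposition D1\*).** The correctly-scoped version of the strategists' D1 split: child 2 =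
  `TwistGap.TgLowEnergyCondensation` (stmt-1510, verbatim, NECESSARY: `tgLowEnergyCondensation_of_lowEnergyRigidity`
  in tree) and child 1\* = `ConditionalSelection` ("in-window zero-momentum selection wherever infrared
  condensation holds"), with `lowEnergyRigidity_of_conditionalSelection : ConditionalSelection →
  TgLowEnergyCondensation → LowEnergyRigidity` and `conditionalSelection_of_tgPairMomentumRigidity :
  TgPairMomentumRigidity → ConditionalSelection` (child 1\* is WEAKER than D1's universal child stmt-1509,
  through the body-level pointwise glue `rigidBodyAt_of_rigidityBodyAt_of_condensationBodyAt`).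

Vocabulary: `RigidBodyAt U δ` is the crux matrix at a point (`lowEnergyRigidity_iff_exists_rigidBodyAt`
is `Iff.rfl`); `CondensationBodyAt` / `RigidityBodyAt` are the bodies of stmt-1510 / stmt-1509 at a point
(`Iff.rfl` again). All proofs are finite-dimensional linear algebra over the tree's seeded-family lemmas
(`Theorems/TwTipContinuation/Negative/SeededChords.lean`) and the a-priori bound `re⟨φ,Pφ⟩ ≤ 32L⁴`
(`Theorems/DeformationLadderLadderThesisRigidityReduction.lean`). Kaplan–Horsch–von der Linden (1989)
variational chords; Tasaki (2020) §2.1. [folklore]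
-/

noncomputable section

namespace Summit.HubbardSuperconductivity.HubbardSuperconductivity.Cruxes.LowEnergyRigidity.StrategistS2

set_option linter.dupNamespace false

open Matrix
open Literature.MathematicalPhysics.QuantumLattice Literature.Probability.LatticeModels
open Summit.HubbardSuperconductivity.HubbardSuperconductivity.Theses.DeformationLadder
open Summit.HubbardSuperconductivity.HubbardSuperconductivity.Theses.TwistGap
  (TgPairMomentumRigidity TgLowEnergyCondensation)
open Summit.HubbardSuperconductivity.TwTipContinuation.Negative
open Summit.HubbardSuperconductivity.HubbardSuperconductivity.Theorems.TwistGap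
  (windowSum_eq_zero_add pairMode_zero tgLowEnergyCondensation_of_lowEnergyRigidity)
open Summit.HubbardSuperconductivity.HubbardSuperconductivity.Theorems.DeformationLadder
  (re_expect_pairPenalty_le)
open scoped ComplexOrder

/-- The d-wave pair intensity `P_L = pFᴴ pF` (so `Π_L = L⁻⁴ P_L`). -/
local notation "𝐏" L:max => ((pairField dWaveFormFactor L)ᴴ * pairField dWaveFormFactor L)

/-- The crux's sector `(N_L, S^z = 0)`, `N_L = 2⌊(1-δ)L²/2⌋`. -/
local notation "𝐊" L:max δ:max =>
  (szSector (Λ := FermionTorus 2 L) (2 * ⌊(1 - δ) * (L : ℝ) ^ 2 / 2⌋₊) 0)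

/-! ## Bodies at a point -/

/-- The crux matrix at a point `(U, δ)` (the `∃ κ a L₀ ∀ L …` body of `LowEnergyRigidity`). [folklore] -/
def RigidBodyAt (U δ : ℝ) : Prop :=
  ∃ κ : ℝ, 0 < κ ∧ ∃ a : ℝ, 0 < a ∧ ∃ L₀ : ℕ, ∀ (L : ℕ) [NeZero L], L₀ ≤ L → Even L →
    ∀ φ : Fock (Orb (FermionTorus 2 L)), φ ∈ 𝐊 L δ → star φ ⬝ᵥ φ = 1 →
      (star φ ⬝ᵥ (hubbardTorus 2 L 1 U) *ᵥ φ).re ≤ (hubbardTorus 2 L 1 U).minEnergyOn (𝐊 L δ) + κ →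
      a ≤ (expect (𝐏 L) φ).re / (L : ℝ) ^ 4

/-- `LowEnergyRigidity` is literally `∃ (U, δ), RigidBodyAt U δ`. [folklore] -/
theorem lowEnergyRigidity_iff_exists_rigidBodyAt :
    LowEnergyRigidity ↔ ∃ U : ℝ, 0 < U ∧ ∃ δ ∈ Set.Ioo (0 : ℝ) (1 / 2), RigidBodyAt U δ :=
  Iff.rfl

/-- The body of `TwistGap.TgLowEnergyCondensation` (stmt-1510) at a point. [folklore] -/
def CondensationBodyAt (U δ : ℝ) : Prop :=
  ∃ K : ℕ, ∃ θ : ℝ, 0 < θ ∧ ∃ Γ : ℝ, 0 < Γ ∧ ∃ L₀ : ℕ, ∀ (L : ℕ) [NeZero L], L₀ ≤ L → Even L →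
    ∀ φ : Fock (Orb (FermionTorus 2 L)), φ ∈ 𝐊 L δ → star φ ⬝ᵥ φ = 1 →
      (expect (hubbardTorus 2 L 1 U) φ).re ≤ (hubbardTorus 2 L 1 U).minEnergyOn (𝐊 L δ) + Γ →
      θ ≤ (∑ k ∈ (Finset.univ.filter
          (fun k : TorusSite 2 L => ∀ i : Fin 2, min (k i).val (L - (k i).val) ≤ K)),
        (expect (Matrix.conjTranspose (∑ x : TorusSite 2 L,
            Complex.exp (-(2 * (Real.pi : ℂ) * Complex.I / (L : ℂ)) *
              ((∑ i : Fin 2, (k i).val * (x i).val : ℕ) : ℂ)) • localPair dWaveFormFactor L x) *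
          (∑ x : TorusSite 2 L, Complex.exp (-(2 * (Real.pi : ℂ) * Complex.I / (L : ℂ)) *
              ((∑ i : Fin 2, (k i).val * (x i).val : ℕ) : ℂ)) • localPair dWaveFormFactor L x)) φ).re /
          (L : ℝ) ^ 4)

/-- The body of `TwistGap.TgPairMomentumRigidity` (stmt-1509) at a point. [folklore] -/
def RigidityBodyAt (U δ : ℝ) : Prop :=
  ∀ (K : ℕ) (σ : ℝ), 0 < σ → ∃ γ : ℝ, 0 < γ ∧ ∃ L₀ : ℕ, ∀ (L : ℕ) [NeZero L], L₀ ≤ L → Even L →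
    ∀ φ : Fock (Orb (FermionTorus 2 L)), φ ∈ 𝐊 L δ → star φ ⬝ᵥ φ = 1 →
      γ * ((∑ k ∈ (Finset.univ.filter
          (fun k : TorusSite 2 L => k ≠ 0 ∧ ∀ i : Fin 2, min (k i).val (L - (k i).val) ≤ K)),
        (expect (Matrix.conjTranspose (∑ x : TorusSite 2 L,
            Complex.exp (-(2 * (Real.pi : ℂ) * Complex.I / (L : ℂ)) *
              ((∑ i : Fin 2, (k i).val * (x i).val : ℕ) : ℂ)) • localPair dWaveFormFactor L x) *
          (∑ x : TorusSite 2 L, Complex.exp (-(2 * (Real.pi : ℂ) * Complex.I / (L : ℂ)) *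
              ((∑ i : Fin 2, (k i).val * (x i).val : ℕ) : ℂ)) • localPair dWaveFormFactor L x)) φ).re /
          (L : ℝ) ^ 4) - σ) ≤
        (expect (hubbardTorus 2 L 1 U) φ).re - (hubbardTorus 2 L 1 U).minEnergyOn (𝐊 L δ)

/-- stmt-1510 is literally `∃ (U, δ), CondensationBodyAt U δ`. [folklore] -/
theorem tgLowEnergyCondensation_iff :
    TgLowEnergyCondensation ↔ ∃ U : ℝ, 0 < U ∧ ∃ δ ∈ Set.Ioo (0 : ℝ) (1 / 2), CondensationBodyAt U δ :=
  Iff.rfl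

/-- stmt-1509 is literally `∀ (U, δ), RigidityBodyAt U δ`. [folklore] -/
theorem tgPairMomentumRigidity_iff :
    TgPairMomentumRigidity ↔ ∀ U : ℝ, 0 < U → ∀ δ ∈ Set.Ioo (0 : ℝ) (1 / 2), RigidityBodyAt U δ :=
  Iff.rfl

/-! ## D13 = D1\*: conditional selection × infrared condensation -/

/-- **Body-level pointwise D1 glue**: at a point, the 1509 body and the 1510 body give the crux body with
`(κ, a) = (min Γ (γθ/4), θ/4)` (the arithmetic of `TwistGap.lowEnergyRigidity_of_tgCruxes`, kept at the
point). [folklore] -/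
theorem rigidBodyAt_of_rigidityBodyAt_of_condensationBodyAt {U δ : ℝ}
    (hR : RigidityBodyAt U δ) (hC : CondensationBodyAt U δ) : RigidBodyAt U δ := by
  obtain ⟨K, θ, hθ, Γ, hΓ, L₀, hC⟩ := hC
  obtain ⟨γ, hγ, L₁, hR⟩ := hR K (θ / 2) (by positivity)
  refine ⟨min Γ (γ * (θ / 4)), lt_min hΓ (by positivity), θ / 4, by positivity, max L₀ L₁,
    fun L _ hL hev φ hmem hφ1 hE => ?_⟩
  have hmin₁ : min Γ (γ * (θ / 4)) ≤ Γ := min_le_left _ _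
  have hmin₂ : min Γ (γ * (θ / 4)) ≤ γ * (θ / 4) := min_le_right _ _
  have hEΓ : (expect (hubbardTorus 2 L 1 U) φ).re ≤
      (hubbardTorus 2 L 1 U).minEnergyOn (𝐊 L δ) + Γ := by
    unfold expect
    linarith
  have hEγ : (expect (hubbardTorus 2 L 1 U) φ).re - (hubbardTorus 2 L 1 U).minEnergyOn (𝐊 L δ) ≤
      γ * (θ / 4) := by
    unfold expect
    linarith
  have h1 := hC L (le_of_max_le_left hL) hev φ hmem hφ1 hEΓ
  have h2 := hR L (le_of_max_le_right hL) hev φ hmem hφ1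
  have h3 := le_of_mul_le_mul_left (h2.trans hEγ) hγ
  rw [windowSum_eq_zero_add] at h1
  simp only [pairMode_zero] at h1
  linarith

/-- **Child 1\* of D13**: zero-momentum SELECTION inside the infrared window, asked only where low-energy
infrared condensation holds — `∀ (U, δ)`, (1510 body at `(U,δ)`) → (crux body at `(U,δ)`). [folklore] -/
def ConditionalSelection : Prop :=
  ∀ U : ℝ, 0 < U → ∀ δ ∈ Set.Ioo (0 : ℝ) (1 / 2), CondensationBodyAt U δ → RigidBodyAt U δ

/-- Child 1\* is implied by D1's universal child stmt-1509 (so D13 is a weakening of D1 on the stiffness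
side; the condensation side is unchanged). [folklore] -/
theorem conditionalSelection_of_tgPairMomentumRigidity (hR : TgPairMomentumRigidity) :
    ConditionalSelection :=
  fun U hU δ hδ hC => rigidBodyAt_of_rigidityBodyAt_of_condensationBodyAt (hR U hU δ hδ) hC

/-- **D13 glue**: `ConditionalSelection → TgLowEnergyCondensation → LowEnergyRigidity` (modus ponens at
the witness of stmt-1510). [folklore] -/
theorem lowEnergyRigidity_of_conditionalSelection (hS : ConditionalSelection)
    (hC : TgLowEnergyCondensation) : LowEnergyRigidity := by
  obtain ⟨U, hU, δ, hδ, hCb⟩ := hC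
  exact ⟨U, hU, δ, hδ, hS U hU δ hδ hCb⟩

/-- The condensation child is NECESSARY (in tree): crux → stmt-1510. Recorded by name. -/
example : LowEnergyRigidity → TgLowEnergyCondensation := tgLowEnergyCondensation_of_lowEnergyRigidity

/-! ## S15: uniform-in-coupling window rigidity of the deformed family ⟺ the crux -/

/-- Window rigidity of `K_L(U,g) = H_L − (g/L²)P_L`, with ONE set of constants `(κ, a, L₀)` for every
coupling `g` in a short interval `(0, g₀]`. [folklore] -/
def UniformDeformedWindowRigidity : Prop :=
  ∃ U : ℝ, 0 < U ∧ ∃ δ ∈ Set.Ioo (0 : ℝ) (1 / 2), ∃ g₀ : ℝ, 0 < g₀ ∧ ∃ κ : ℝ, 0 < κ ∧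
    ∃ a : ℝ, 0 < a ∧ ∃ L₀ : ℕ, ∀ g ∈ Set.Ioc (0 : ℝ) g₀, ∀ (L : ℕ) [NeZero L], L₀ ≤ L → Even L →
      ∀ φ : Fock (Orb (FermionTorus 2 L)), φ ∈ 𝐊 L δ → star φ ⬝ᵥ φ = 1 →
        (expect (hubbardTorus 2 L 1 U - ((g / (L : ℝ) ^ 2 : ℝ) : ℂ) • 𝐏 L) φ).re ≤
          (hubbardTorus 2 L 1 U - ((g / (L : ℝ) ^ 2 : ℝ) : ℂ) • 𝐏 L).minEnergyOn (𝐊 L δ) + κ →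
        a ≤ (expect (𝐏 L) φ).re / (L : ℝ) ^ 4

/-- Window rigidity of `K_L(U,g)` with ONE set of constants for EVERY `g ≥ 0`. [folklore] -/
def AllCouplingsWindowRigidity : Prop :=
  ∃ U : ℝ, 0 < U ∧ ∃ δ ∈ Set.Ioo (0 : ℝ) (1 / 2), ∃ κ : ℝ, 0 < κ ∧ ∃ a : ℝ, 0 < a ∧ ∃ L₀ : ℕ,
    ∀ g : ℝ, 0 ≤ g → ∀ (L : ℕ) [NeZero L], L₀ ≤ L → Even L →
      ∀ φ : Fock (Orb (FermionTorus 2 L)), φ ∈ 𝐊 L δ → star φ ⬝ᵥ φ = 1 →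
        (expect (hubbardTorus 2 L 1 U - ((g / (L : ℝ) ^ 2 : ℝ) : ℂ) • 𝐏 L) φ).re ≤
          (hubbardTorus 2 L 1 U - ((g / (L : ℝ) ^ 2 : ℝ) : ℂ) • 𝐏 L).minEnergyOn (𝐊 L δ) + κ →
        a ≤ (expect (𝐏 L) φ).re / (L : ℝ) ^ 4

/-- **Uniform deformed window rigidity on any `(0, g₀]` gives the crux** (with `κ/2, a`): at side `L` use
the coupling `g = min g₀ (κ/(64L²))`; a pure window vector is a deformed window vector because the
attraction only lowers its energy (`P_L ≥ 0`) while it lowers the sector energy by at most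
`(g/L²)·32L⁴ ≤ κ/2` (`re⟨χ,Pχ⟩ ≤ 32L⁴`). [folklore] -/
theorem lowEnergyRigidity_of_uniformDeformedWindowRigidity (h : UniformDeformedWindowRigidity) :
    LowEnergyRigidity := by
  obtain ⟨U, hU, δ, hδ, g₀, hg₀, κ, hκ, a, ha, L₀, h⟩ := h
  refine ⟨U, hU, δ, hδ, κ / 2, by positivity, a, ha, L₀, fun L _ hL hev φ hmem hφ1 hE => ?_⟩
  have hLpos : (0 : ℝ) < (L : ℝ) := by exact_mod_cast Nat.pos_of_ne_zero (NeZero.ne L)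
  have hL2 : (0 : ℝ) < (L : ℝ) ^ 2 := by positivity
  -- the coupling used at this side
  set g : ℝ := min g₀ (κ / (64 * (L : ℝ) ^ 2)) with hg_def
  have hgpos : 0 < g := lt_min hg₀ (by positivity)
  have hgle : g ≤ g₀ := min_le_left _ _
  have hgκ : g ≤ κ / (64 * (L : ℝ) ^ 2) := min_le_right _ _
  -- the sector index is admissible
  have hφne : φ ≠ 0 := by
    intro h0
    rw [h0, dotProduct_zero] at hφ1
    exact zero_ne_one hφ1
  have hn := le_card_of_mem_szSector L hmem hφne
  -- (a) the attraction only lowers the energy of `φ`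
  have ra := expect_seededH_re U 0 L g φ
  rw [seededH_zero, sub_zero] at ra
  have hPφ := expect_pairIntensity_nonneg L φ
  have hga : 0 ≤ g / (L : ℝ) ^ 2 * (expect (𝐏 L) φ).re := mul_nonneg (div_nonneg hgpos.le hL2.le) hPφ
  -- (b) the pure window hypothesis, as an `expect`
  have hb : (expect (hubbardTorus 2 L 1 U) φ).re ≤ (hubbardTorus 2 L 1 U).minEnergyOn (𝐊 L δ) + κ / 2 := by
    unfold expect
    exact hE
  -- (c) the attraction lowers the sector energy by at most `32 g L² ≤ κ/2`
  obtain ⟨χ, hχ1, hχgs⟩ := exists_unit_groundState U g L hn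
  obtain ⟨-, hb0⟩ := seeded_sector_groundState U 0 L hn
  have v0 := hb0 χ hχgs.1 hχ1
  rw [seededH_zero] at v0
  have rc := expect_seededH_re U g L 0 χ
  rw [seededH_zero, zero_sub] at rc
  have eχ : (expect (hubbardTorus 2 L 1 U - ((g / (L : ℝ) ^ 2 : ℝ) : ℂ) • 𝐏 L) χ).re =
      (hubbardTorus 2 L 1 U - ((g / (L : ℝ) ^ 2 : ℝ) : ℂ) • 𝐏 L).minEnergyOn (𝐊 L δ) := by
    rw [expect_eq_of_groundState L hχ1 hχgs, Complex.ofReal_re]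
  have hPχ := re_expect_pairPenalty_le L hχ1
  have hc1 : g / (L : ℝ) ^ 2 * (expect (𝐏 L) χ).re ≤ κ / 2 := by
    calc g / (L : ℝ) ^ 2 * (expect (𝐏 L) χ).re
        ≤ g / (L : ℝ) ^ 2 * (32 * (L : ℝ) ^ 4) :=
          mul_le_mul_of_nonneg_left hPχ (div_nonneg hgpos.le hL2.le)
      _ = g * (32 * (L : ℝ) ^ 2) := by
          field_simp
      _ ≤ κ / (64 * (L : ℝ) ^ 2) * (32 * (L : ℝ) ^ 2) :=
          mul_le_mul_of_nonneg_right hgκ (by positivity)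
      _ = κ / 2 := by
          field_simp
          ring
  have hc2 : (-g) / (L : ℝ) ^ 2 * (expect (𝐏 L) χ).re = -(g / (L : ℝ) ^ 2 * (expect (𝐏 L) χ).re) := by
    ring
  have hc : (hubbardTorus 2 L 1 U).minEnergyOn (𝐊 L δ) ≤
      (hubbardTorus 2 L 1 U - ((g / (L : ℝ) ^ 2 : ℝ) : ℂ) • 𝐏 L).minEnergyOn (𝐊 L δ) + κ / 2 := by
    linarith
  -- (d) `φ` is a window vector of the deformed model at coupling `g`
  have hwin : (expect (hubbardTorus 2 L 1 U - ((g / (L : ℝ) ^ 2 : ℝ) : ℂ) • 𝐏 L) φ).re ≤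
      (hubbardTorus 2 L 1 U - ((g / (L : ℝ) ^ 2 : ℝ) : ℂ) • 𝐏 L).minEnergyOn (𝐊 L δ) + κ := by
    linarith
  exact h g ⟨hgpos, hgle⟩ L hL hev φ hmem hφ1 hwin

/-- **The crux gives window rigidity of the deformed model at EVERY `g ≥ 0`, with the same constants**:
for a window vector `φ` at coupling `g`, either its pair intensity is at most that of a pure sector
ground state `ψ` — then the two variational chords put `φ` in the pure `κ`-window — or it exceeds
`re⟨ψ,Pψ⟩ ≥ a L⁴` outright (`ψ` is in the pure window). [folklore] -/
theorem allCouplingsWindowRigidity_of_lowEnergyRigidity (h : LowEnergyRigidity) :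
    AllCouplingsWindowRigidity := by
  obtain ⟨U, hU, δ, hδ, κ, hκ, a, ha, L₀, h⟩ := h
  refine ⟨U, hU, δ, hδ, κ, hκ, a, ha, L₀, fun g hg L _ hL hev φ hmem hφ1 hE => ?_⟩
  have hLpos : (0 : ℝ) < (L : ℝ) := by exact_mod_cast Nat.pos_of_ne_zero (NeZero.ne L)
  have hL2 : (0 : ℝ) < (L : ℝ) ^ 2 := by positivity
  have hL4 : (0 : ℝ) < (L : ℝ) ^ 4 := by positivity
  have hφne : φ ≠ 0 := by
    intro h0
    rw [h0, dotProduct_zero] at hφ1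
    exact zero_ne_one hφ1
  have hn := le_card_of_mem_szSector L hmem hφne
  -- a normalised pure sector ground state `ψ`; it lies in the pure window, so it carries LRO `≥ a`
  obtain ⟨ψ, hψ1, hψgs⟩ := exists_unit_groundState U 0 L hn
  rw [seededH_zero] at hψgs
  have eψ : (expect (hubbardTorus 2 L 1 U) ψ).re = (hubbardTorus 2 L 1 U).minEnergyOn (𝐊 L δ) := by
    rw [expect_eq_of_groundState L hψ1 hψgs, Complex.ofReal_re]
  have hψwin : (star ψ ⬝ᵥ (hubbardTorus 2 L 1 U) *ᵥ ψ).re ≤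
      (hubbardTorus 2 L 1 U).minEnergyOn (𝐊 L δ) + κ := by
    have e : (star ψ ⬝ᵥ (hubbardTorus 2 L 1 U) *ᵥ ψ).re = (expect (hubbardTorus 2 L 1 U) ψ).re := rfl
    linarith
  have haψ : a ≤ (expect (𝐏 L) ψ).re / (L : ℝ) ^ 4 := h L hL hev ψ hψgs.1 hψ1 hψwin
  -- the two chords at coupling `g`
  obtain ⟨-, hbg⟩ := seeded_sector_groundState U g L hn
  have vg := hbg ψ hψgs.1 hψ1
  have rψ := expect_seededH_re U 0 L g ψ
  have rφ := expect_seededH_re U 0 L g φ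
  rw [seededH_zero, sub_zero] at rψ rφ
  by_cases hcase : (expect (𝐏 L) φ).re ≤ (expect (𝐏 L) ψ).re
  · -- `φ` is a pure window vector
    have hx : g / (L : ℝ) ^ 2 * (expect (𝐏 L) φ).re ≤ g / (L : ℝ) ^ 2 * (expect (𝐏 L) ψ).re :=
      mul_le_mul_of_nonneg_left hcase (div_nonneg hg hL2.le)
    have hφwin : (star φ ⬝ᵥ (hubbardTorus 2 L 1 U) *ᵥ φ).re ≤
        (hubbardTorus 2 L 1 U).minEnergyOn (𝐊 L δ) + κ := by
      have e : (star φ ⬝ᵥ (hubbardTorus 2 L 1 U) *ᵥ φ).re = (expect (hubbardTorus 2 L 1 U) φ).re := rfl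
      linarith
    exact h L hL hev φ hmem hφ1 hφwin
  · -- `φ` has more pair intensity than the ground state `ψ`
    have hlt : (expect (𝐏 L) ψ).re < (expect (𝐏 L) φ).re := not_le.mp hcase
    exact haψ.trans (div_le_div_of_nonneg_right hlt.le hL4.le)

/-- Trivial direction: all couplings ⟹ a short interval. [folklore] -/
theorem uniformDeformedWindowRigidity_of_allCouplings (h : AllCouplingsWindowRigidity) :
    UniformDeformedWindowRigidity := by
  obtain ⟨U, hU, δ, hδ, κ, hκ, a, ha, L₀, h⟩ := h
  exact ⟨U, hU, δ, hδ, 1, one_pos, κ, hκ, a, ha, L₀,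
    fun g hg L _ hL hev φ hmem hφ1 hE => h g hg.1.le L hL hev φ hmem hφ1 hE⟩

/-- **S15, first form**: window rigidity uniform on a short coupling interval `(0, g₀]` ⟺ the crux. -/
theorem lowEnergyRigidity_iff_uniformDeformedWindowRigidity :
    LowEnergyRigidity ↔ UniformDeformedWindowRigidity :=
  ⟨fun h => uniformDeformedWindowRigidity_of_allCouplings (allCouplingsWindowRigidity_of_lowEnergyRigidity h),
    lowEnergyRigidity_of_uniformDeformedWindowRigidity⟩

/-- **S15, second form**: the crux ⟺ window rigidity uniform on the whole attractive half-line `g ≥ 0`. -/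
theorem lowEnergyRigidity_iff_allCouplingsWindowRigidity :
    LowEnergyRigidity ↔ AllCouplingsWindowRigidity :=
  ⟨allCouplingsWindowRigidity_of_lowEnergyRigidity,
    fun h => lowEnergyRigidity_of_uniformDeformedWindowRigidity (uniformDeformedWindowRigidity_of_allCouplings h)⟩

end Summit.HubbardSuperconductivity.HubbardSuperconductivity.Cruxes.LowEnergyRigidity.StrategistS2
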